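import Literature.Dynamics.TransferOperators.HurwitzTrapezoid
import Mathlib.Analysis.Normed.Ring.InfiniteSum
import Mathlib.Algebra.Order.Antidiag.Prod
import Mathlib.Algebra.BigOperators.NatAntidiagonal
import HarnessLib

/-!
# Zagier's period function of the Eisenstein series: continued form and the Lewis equation

Zagier observed [Zag92b; ChangMayer2001, (2.45)] that for `Re s > 1` the function

  `ψ_s(z) = ∑_{m,n ≥ 1} (mz+n)^{-2s} + ½ ζ(2s) (1 + z^{-2s})`        (`Re z > 0`)

solves the Lewis three-term equation `ψ(z) = ψ(z+1) + (z+1)^{-2s} ψ(z/(z+1))`, and that it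
continues analytically in `s`; Chang–Mayer [ChangMayer2001, Prop. 4.1(v); CM98] showed that
`f_β(z) = ψ_β(z+1)` is an eigenfunction of Mayer's transfer operator `L_β` with eigenvalue `1`
whenever `ζ(2β) = 0`. This file constructs the continuation EXPLICITLY (with `σ = 2s`):

  `zagierPsi σ z = ∑_{m ≥ 1} R(σ, m z) + z^{1-σ} ζ(σ-1)/(σ-1) + ζ(σ)/2`,

where `R = hurwitzR` is the trapezoid remainder of `∑ₙ (n+b)^{-σ}` (`HurwitzTrapezoid.lean`); the
`m`-series converges for `Re σ > 0` because `R(σ, b) = O((Re b)^{-Re σ/2-1})`.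

## Contents

* `mul_cpow_of_re_pos` — `(w u)^s = w^s u^s` for `Re w, Re u > 0` (principal branches), and the
  branch identity `w^s (1 + 1/w)^s = (w+1)^s`.
* `zagierPsi`, `summable_hurwitzR_mul`, `norm_tsum_hurwitzR_mul_le` (the `m`-series is
  `O((Re z)^{-Re σ/2-1})`), `differentiableOn_zagierPsi_right` (holomorphy in `z` on `{Re z > 0}`).
* `zagierPsi_eq_tsum_add` — the LATTICE FORM for `Re σ > 2`:
  `ψ(σ, z) = ∑_{m≥0} ∑_{n≥0} (n + (m+1)z)^{-σ} + ½ζ(σ)(1 - z^{-σ})` (which is Zagier's formula, the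
  `n = 0` column being `z^{-σ} ζ(σ)`), via `hurwitzR_eq_tsum_sub` and `ζ(τ) = ∑ (m+1)^{-τ}`.
* `zagierPsi_lewis_of_two_lt` — the LEWIS EQUATION for `Re σ > 2`, `Re w > 0`, in the form used by
  the transfer operator [ChangMayer2001, (2.49) with `λ = 1`]:
  `ψ(σ, w) - ψ(σ, w+1) = w^{-σ} ψ(σ, 1 + 1/w)`, by rearranging absolutely convergent lattice
  sums: the rows of `ψ(w+1)` are tails of the rows of `ψ(w)` (`tsum_row_sub_tsum_row_add_one`),
  the third term is the transposed strict triangle (`cpow_mul_row_one_add_div`, `summable_diag`,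
  `hasSum_diag` — regrouping along antidiagonals), and the rest telescopes to
  `ζ(σ)(w^{-σ} - (w+1)^{-σ})`.

The continuation of the Lewis equation to the strip `0 < Re σ < 1` (identity theorem in `σ`), the
value `ψ(σ, 1) = ζ(σ-1)` and `ζ(σ-1) ≠ 0` are in `ZagierPsiContinuation.lean`; the eigenfunction
statement is in `ChangMayerEigenfunction.lean`.

## References

* [ChangMayer2001] C.-H. Chang, D. Mayer, Eigenfunctions of the transfer operators and the period
  functions for modular groups, Contemp. Math. 290 (2001) 1–40: (2.45), §2.4.6, Prop. 4.1(v),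
  Prop. 4.2, Cor. 4.3.
* [CM98] C.-H. Chang, D. Mayer, The period function of the nonholomorphic Eisenstein series for
  PSL(2,ℤ), Math. Phys. Electron. J. 4 (1998), paper 6.
* [LZ01] J. Lewis, D. Zagier, Period functions for Maass wave forms. I, Ann. Math. 153 (2001), Ch. IV.
-/

noncomputable section

open Complex Metric Set Filter Topology Real

namespace Literature.Dynamics.TransferOperators

/-! ### Products and powers in the right half-plane -/

/-- For `Re w > 0`, `Re u > 0`: `log (w u) = log w + log u` (both arguments lie in
`(-π/2, π/2)`, so their sum is a valid principal argument). [folklore] -/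
theorem log_mul_of_re_pos {w u : ℂ} (hw : 0 < w.re) (hu : 0 < u.re) :
    Complex.log (w * u) = Complex.log w + Complex.log u := by
  have hw0 : w ≠ 0 := fun h => by rw [h, zero_re] at hw; exact lt_irrefl _ hw
  have hu0 : u ≠ 0 := fun h => by rw [h, zero_re] at hu; exact lt_irrefl _ hu
  have haw : |arg w| < π / 2 := abs_arg_lt_pi_div_two_iff.mpr (Or.inl hw)
  have hau : |arg u| < π / 2 := abs_arg_lt_pi_div_two_iff.mpr (Or.inl hu)
  have h1 : Complex.exp (Complex.log w + Complex.log u) = w * u := by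
    rw [Complex.exp_add, Complex.exp_log hw0, Complex.exp_log hu0]
  rw [← h1, Complex.log_exp]
  · simp only [add_im, Complex.log_im]
    have := (abs_lt.mp haw).1; have := (abs_lt.mp hau).1
    linarith
  · simp only [add_im, Complex.log_im]
    have := (abs_lt.mp haw).2; have := (abs_lt.mp hau).2
    linarith

/-- **Multiplicativity of principal powers in the right half-plane**: for `Re w > 0`, `Re u > 0`
and any `s`, `(w u)^s = w^s u^s`. [folklore] -/
theorem mul_cpow_of_re_pos {w u : ℂ} (hw : 0 < w.re) (hu : 0 < u.re) (s : ℂ) :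
    (w * u) ^ s = w ^ s * u ^ s := by
  have hw0 : w ≠ 0 := fun h => by rw [h, zero_re] at hw; exact lt_irrefl _ hw
  have hu0 : u ≠ 0 := fun h => by rw [h, zero_re] at hu; exact lt_irrefl _ hu
  rw [cpow_def_of_ne_zero (mul_ne_zero hw0 hu0), cpow_def_of_ne_zero hw0, cpow_def_of_ne_zero hu0,
    log_mul_of_re_pos hw hu, add_mul, Complex.exp_add]

/-- `Re (1 + 1/w) > 0` for `Re w > 0`. [folklore] -/
theorem one_add_one_div_re_pos {w : ℂ} (hw : 0 < w.re) : 0 < (1 + 1 / w).re := by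
  have h : 0 < (1 / w).re := by
    rw [one_div, inv_re]
    exact div_pos hw (normSq_pos.mpr fun h => by rw [h, zero_re] at hw; exact lt_irrefl _ hw)
  simp only [add_re, one_re]
  linarith

/-- The branch identity `w^s (1 + 1/w)^s = (w + 1)^s` for `Re w > 0`. [folklore] -/
theorem cpow_mul_one_add_one_div_cpow {w : ℂ} (hw : 0 < w.re) (s : ℂ) :
    w ^ s * (1 + 1 / w) ^ s = (w + 1) ^ s := by
  have hw0 : w ≠ 0 := fun h => by rw [h, zero_re] at hw; exact lt_irrefl _ hw
  rw [← mul_cpow_of_re_pos hw (one_add_one_div_re_pos hw)]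
  congr 1
  field_simp

/-- `((m+1) z)^s = (m+1)^s z^s` for `Re z > 0`. [folklore] -/
theorem natCast_succ_mul_cpow {z : ℂ} (hz : 0 < z.re) (m : ℕ) (s : ℂ) :
    (((m : ℂ) + 1) * z) ^ s = ((m : ℂ) + 1) ^ s * z ^ s :=
  mul_cpow_of_re_pos (by simp only [add_re, natCast_re, one_re]; positivity) hz s

/-- `Re ((m+1) z) = (m+1) Re z`. [folklore] -/
theorem natCast_succ_mul_re (z : ℂ) (m : ℕ) : (((m : ℂ) + 1) * z).re = ((m : ℝ) + 1) * z.re := by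
  simp [mul_re]

/-! ### Zagier's function -/

/-- **Zagier's period function of the non-holomorphic Eisenstein series, continued form.**
For `σ = 2β` and `Re z > 0`,

  `ψ(σ, z) = ∑_{m ≥ 1} R(σ, m z) + z^{1-σ} ζ(σ-1)/(σ-1) + ζ(σ)/2`,

where `R(σ, b) = hurwitzR σ b` is the second-order Euler–Maclaurin remainder of `∑ₙ (n+b)^{-σ}`.
For `Re σ > 2` this equals Zagier's `∑_{m,n ≥ 1} (mz+n)^{-σ} + ½ζ(σ)(1 + z^{-σ})` [Zag92b;
ChangMayer2001, (2.45), (4.31)] (`zagierPsi_eq_zagier` below; `zagierPsi_eq_tsum_add` gives the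
equivalent form `∑_{m≥1} ∑_{n≥0} (mz+n)^{-σ} + ½ζ(σ)(1 - z^{-σ})`); the defining expression converges
for `Re σ > 0`
(`σ ≠ 1`) and is the analytic continuation in `σ` (holomorphic off `σ ∈ {1, 2}`; at `σ = 1` the poles
of the last two terms cancel, at `σ = 2`, i.e. `β = 1`, there is a genuine pole). Junk values: at
`σ = 1, 2` (Lean's `x/0 = 0` and Mathlib's value of `ζ(1)`). [cite: ChangMayer2001, Prop. 4.1(v) and (2.45)] -/
def zagierPsi (σ z : ℂ) : ℂ :=
  ∑' m : ℕ, hurwitzR σ (((m : ℂ) + 1) * z) + z ^ (1 - σ) * riemannZeta (σ - 1) / (σ - 1) +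
    riemannZeta σ / 2

/-- Unfolding lemma for `zagierPsi`. [folklore] -/
theorem zagierPsi_def (σ z : ℂ) : zagierPsi σ z =
    ∑' m : ℕ, hurwitzR σ (((m : ℂ) + 1) * z) + z ^ (1 - σ) * riemannZeta (σ - 1) / (σ - 1) +
      riemannZeta σ / 2 := rfl

/-! ### Convergence of the `m`-series -/

/-- Norm bound for the `m`-th term: for `σ ≠ 1`, `Re σ > 0`, `0 < x₀ ≤ Re z`,
`‖R(σ, (m+1)z)‖ ≤ K(σ) Z(x₀, Re σ) (Re z)^{-(Re σ/2+1)} (m+1)^{-(Re σ/2+1)}`. [folklore] -/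
theorem norm_hurwitzR_mul_le {σ z : ℂ} {x₀ : ℝ} (hσ1 : σ ≠ 1) (hσ : 0 < σ.re) (hx₀ : 0 < x₀)
    (hz : x₀ ≤ z.re) (m : ℕ) :
    ‖hurwitzR σ (((m : ℂ) + 1) * z)‖ ≤
      trapConst σ * (∑' n : ℕ, ((n : ℝ) + x₀) ^ (-(σ.re / 2 + 1))) *
        z.re ^ (-(σ.re / 2 + 1)) * ((m : ℝ) + 1) ^ (-(σ.re / 2 + 1)) := by
  have hzpos : 0 < z.re := hx₀.trans_le hz
  have hre : (((m : ℂ) + 1) * z).re = ((m : ℝ) + 1) * z.re := natCast_succ_mul_re z m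
  have hb : x₀ ≤ (((m : ℂ) + 1) * z).re := by
    rw [hre]
    have : (1 : ℝ) * z.re ≤ ((m : ℝ) + 1) * z.re :=
      mul_le_mul_of_nonneg_right (by linarith [m.cast_nonneg (α := ℝ)]) hzpos.le
    linarith
  refine (norm_hurwitzR_le_decay hσ1 hσ hx₀ hb).trans_eq ?_
  rw [hre, Real.mul_rpow (by positivity) hzpos.le]
  ring

/-- **The `m`-series of `zagierPsi` converges absolutely** for `σ ≠ 1`, `Re σ > 0`, `Re z > 0`.
[folklore] -/
theorem summable_hurwitzR_mul {σ z : ℂ} (hσ1 : σ ≠ 1) (hσ : 0 < σ.re) (hz : 0 < z.re) :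
    Summable fun m : ℕ => hurwitzR σ (((m : ℂ) + 1) * z) := by
  refine Summable.of_norm_bounded ((summable_nat_add_rpow_neg (x := 1) one_pos
    (by positivity : 0 < σ.re / 2)).mul_left (trapConst σ *
      (∑' n : ℕ, ((n : ℝ) + z.re) ^ (-(σ.re / 2 + 1))) * z.re ^ (-(σ.re / 2 + 1)))) fun m => ?_
  exact norm_hurwitzR_mul_le hσ1 hσ hz le_rfl m

/-- **Bound for the `m`-series**: for `σ ≠ 1`, `Re σ > 0`, `0 < x₀ ≤ Re z`,
`‖∑ₘ R(σ,(m+1)z)‖ ≤ K(σ) Z(x₀, Re σ) (∑ₘ (m+1)^{-(Re σ/2+1)}) (Re z)^{-(Re σ/2+1)}` — it tends to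
`0` as `Re z → ∞`, uniformly. [folklore] -/
theorem norm_tsum_hurwitzR_mul_le {σ z : ℂ} {x₀ : ℝ} (hσ1 : σ ≠ 1) (hσ : 0 < σ.re) (hx₀ : 0 < x₀)
    (hz : x₀ ≤ z.re) :
    ‖∑' m : ℕ, hurwitzR σ (((m : ℂ) + 1) * z)‖ ≤
      trapConst σ * (∑' n : ℕ, ((n : ℝ) + x₀) ^ (-(σ.re / 2 + 1))) *
        (∑' m : ℕ, ((m : ℝ) + 1) ^ (-(σ.re / 2 + 1))) * z.re ^ (-(σ.re / 2 + 1)) := by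
  have hsum := (summable_nat_add_rpow_neg (x := 1) one_pos (by positivity : 0 < σ.re / 2)).mul_left
    (trapConst σ * (∑' n : ℕ, ((n : ℝ) + x₀) ^ (-(σ.re / 2 + 1))) * z.re ^ (-(σ.re / 2 + 1)))
  have h := tsum_of_norm_bounded hsum.hasSum fun m => norm_hurwitzR_mul_le hσ1 hσ hx₀ hz m
  rw [tsum_mul_left] at h
  refine h.trans_eq ?_
  ring

/-! ### Holomorphy in `z` -/

/-- The `m`-series is holomorphic on `{Re z > δ}` for every `δ > 0` (`σ ≠ 1`, `Re σ > 0`; M-test).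
[folklore] -/
theorem differentiableOn_tsum_hurwitzR_mul_of_lt {σ : ℂ} {δ : ℝ} (hσ1 : σ ≠ 1) (hσ : 0 < σ.re)
    (hδ : 0 < δ) :
    DifferentiableOn ℂ (fun z => ∑' m : ℕ, hurwitzR σ (((m : ℂ) + 1) * z)) {z : ℂ | δ < z.re} := by
  have hopen : IsOpen {z : ℂ | δ < z.re} := isOpen_lt continuous_const Complex.continuous_re
  set C : ℝ := trapConst σ * (∑' n : ℕ, ((n : ℝ) + δ) ^ (-(σ.re / 2 + 1))) * δ ^ (-(σ.re / 2 + 1))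
  refine Complex.differentiableOn_tsum_of_summable_norm
    ((summable_nat_add_rpow_neg (x := 1) one_pos (by positivity : 0 < σ.re / 2)).mul_left C)
    (fun m => ?_) hopen ?_
  · refine (differentiableOn_hurwitzR_right hσ1 (by linarith)).comp
      ((differentiableOn_const _).mul differentiableOn_id) fun z hz => ?_
    have hz' : δ < z.re := hz
    show 0 < (((m : ℂ) + 1) * z).re
    rw [natCast_succ_mul_re]
    exact mul_pos (by positivity) (hδ.trans hz')
  · intro m z hz
    have hz' : δ < z.re := hz
    refine (norm_hurwitzR_mul_le hσ1 hσ hδ hz'.le m).trans ?_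
    refine mul_le_mul_of_nonneg_right ?_ (Real.rpow_nonneg (by positivity) _)
    refine mul_le_mul_of_nonneg_left ?_ (mul_nonneg (trapConst_nonneg σ)
      (tsum_nonneg fun n => Real.rpow_nonneg (by positivity) _))
    exact Real.rpow_le_rpow_of_nonpos hδ hz'.le (by linarith)

/-- **`z ↦ ψ(σ, z)` is holomorphic on the right half-plane** (`σ ≠ 1`, `Re σ > 0`). [folklore] -/
theorem differentiableOn_zagierPsi_right {σ : ℂ} (hσ1 : σ ≠ 1) (hσ : 0 < σ.re) :
    DifferentiableOn ℂ (zagierPsi σ) {z : ℂ | 0 < z.re} := by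
  intro z hz
  have hz' : (0 : ℝ) < z.re := hz
  have hmem : z ∈ {c : ℂ | z.re / 2 < c.re} := by
    show z.re / 2 < z.re
    linarith
  have hopen : IsOpen {c : ℂ | z.re / 2 < c.re} := isOpen_lt continuous_const Complex.continuous_re
  have h1 : DifferentiableAt ℂ (fun v => ∑' m : ℕ, hurwitzR σ (((m : ℂ) + 1) * v)) z :=
    (differentiableOn_tsum_hurwitzR_mul_of_lt hσ1 hσ (by positivity : 0 < z.re / 2)).differentiableAt
      (hopen.mem_nhds hmem)
  have hslit : z ∈ slitPlane := mem_slitPlane_iff.mpr (Or.inl hz')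
  have h2 : DifferentiableAt ℂ (fun v : ℂ => v ^ (1 - σ) * riemannZeta (σ - 1) / (σ - 1)) z :=
    ((differentiableAt_id.cpow_const hslit).mul_const _).div_const _
  have h3 : DifferentiableAt ℂ (zagierPsi σ) z := by
    have : zagierPsi σ = fun v => (∑' m : ℕ, hurwitzR σ (((m : ℂ) + 1) * v)) +
        v ^ (1 - σ) * riemannZeta (σ - 1) / (σ - 1) + riemannZeta σ / 2 := by
      ext v; rfl
    rw [this]
    exact (h1.add h2).add_const _
  exact h3.differentiableWithinAt

/-! ### The lattice form for `Re σ > 2` -/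

/-- The rows `n ↦ (n + (m+1) v)^{-σ}` are summable (`Re σ > 1`, `Re v > 0`). [folklore] -/
theorem summable_row {σ v : ℂ} (hσ : 1 < σ.re) (hv : 0 < v.re) (m : ℕ) :
    Summable fun n : ℕ => ((n : ℂ) + ((m : ℂ) + 1) * v) ^ (-σ) :=
  summable_natCast_add_cpow_neg hσ (by rw [natCast_succ_mul_re]; positivity)

/-- The series `∑ₘ (m+1)^{-τ}` converges absolutely for `Re τ > 1` and sums to `ζ(τ)`. [folklore] -/
theorem hasSum_natCast_succ_cpow_neg {τ : ℂ} (hτ : 1 < τ.re) :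
    HasSum (fun m : ℕ => ((m : ℂ) + 1) ^ (-τ)) (riemannZeta τ) := by
  have hs : Summable fun m : ℕ => ((m : ℂ) + 1) ^ (-τ) :=
    summable_natCast_add_cpow_neg (b := 1) hτ (by simp)
  convert hs.hasSum using 1
  rw [zeta_eq_tsum_one_div_nat_add_one_cpow hτ]
  refine tsum_congr fun m => ?_
  rw [cpow_neg, one_div]

/-- **Row evaluation**: for `Re σ > 2`, `Re v > 0`,
`R(σ, (m+1)v) = ∑ₙ (n+(m+1)v)^{-σ} - (m+1)^{1-σ} v^{1-σ}/(σ-1) - (m+1)^{-σ} v^{-σ}/2`. [folklore] -/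
theorem hurwitzR_mul_eq {σ v : ℂ} (hσ : 1 < σ.re) (hv : 0 < v.re) (m : ℕ) :
    hurwitzR σ (((m : ℂ) + 1) * v) = (∑' n : ℕ, ((n : ℂ) + ((m : ℂ) + 1) * v) ^ (-σ)) -
      ((m : ℂ) + 1) ^ (1 - σ) * v ^ (1 - σ) / (σ - 1) - ((m : ℂ) + 1) ^ (-σ) * v ^ (-σ) / 2 := by
  rw [hurwitzR_eq_tsum_sub hσ (by rw [natCast_succ_mul_re]; positivity), natCast_succ_mul_cpow hv,
    natCast_succ_mul_cpow hv]

/-- **The row sums are summable in `m`** for `Re σ > 2`, `Re v > 0`. [folklore] -/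
theorem summable_tsum_row {σ v : ℂ} (hσ : 2 < σ.re) (hv : 0 < v.re) :
    Summable fun m : ℕ => ∑' n : ℕ, ((n : ℂ) + ((m : ℂ) + 1) * v) ^ (-σ) := by
  have hσ1 : σ ≠ 1 := fun h => by rw [h, one_re] at hσ; linarith
  have hR := summable_hurwitzR_mul hσ1 (by linarith) hv
  have hP1 : Summable fun m : ℕ => ((m : ℂ) + 1) ^ (1 - σ) * v ^ (1 - σ) / (σ - 1) := by
    have h := (summable_natCast_add_cpow_neg (b := 1) (σ := σ - 1)
      (by simp only [sub_re, one_re]; linarith) (by simp)).mul_right (v ^ (1 - σ) / (σ - 1))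
    refine h.congr fun m => ?_
    rw [show -(σ - 1) = 1 - σ by ring]
    ring
  have hP2 : Summable fun m : ℕ => ((m : ℂ) + 1) ^ (-σ) * v ^ (-σ) / 2 := by
    have h := (summable_natCast_add_cpow_neg (b := 1) (σ := σ) (by linarith) (by simp)).mul_right
      (v ^ (-σ) / 2)
    refine h.congr fun m => ?_
    ring
  refine ((hR.add hP1).add hP2).congr fun m => ?_
  rw [hurwitzR_mul_eq (by linarith) hv m]
  ring

/-- **Lattice form of Zagier's function** for `Re σ > 2`, `Re z > 0`:
`ψ(σ, z) = ∑_{m ≥ 0} ∑_{n ≥ 0} (n + (m+1) z)^{-σ} + ½ ζ(σ) (1 - z^{-σ})`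
(equivalently `∑_{m,n≥1} (mz+n)^{-σ} + ½ζ(σ)(1 + z^{-σ})`, Zagier's formula).
[cite: ChangMayer2001, (2.45)] -/
theorem zagierPsi_eq_tsum_add {σ z : ℂ} (hσ : 2 < σ.re) (hz : 0 < z.re) :
    zagierPsi σ z = (∑' m : ℕ, ∑' n : ℕ, ((n : ℂ) + ((m : ℂ) + 1) * z) ^ (-σ)) +
      riemannZeta σ / 2 * (1 - z ^ (-σ)) := by
  have hσ1 : σ ≠ 1 := fun h => by rw [h, one_re] at hσ; linarith
  have hR := summable_hurwitzR_mul hσ1 (by linarith) hz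
  have hA : HasSum (fun m : ℕ => ((m : ℂ) + 1) ^ (1 - σ) * (z ^ (1 - σ) / (σ - 1)))
      (riemannZeta (σ - 1) * (z ^ (1 - σ) / (σ - 1))) := by
    have h := (hasSum_natCast_succ_cpow_neg (τ := σ - 1) (by simp only [sub_re, one_re]; linarith)).mul_right
      (z ^ (1 - σ) / (σ - 1))
    refine h.congr_fun fun m => ?_
    rw [show -(σ - 1) = 1 - σ by ring]
  have hB : HasSum (fun m : ℕ => ((m : ℂ) + 1) ^ (-σ) * (z ^ (-σ) / 2))
      (riemannZeta σ * (z ^ (-σ) / 2)) :=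
    (hasSum_natCast_succ_cpow_neg (τ := σ) (by linarith)).mul_right (z ^ (-σ) / 2)
  have hH := summable_tsum_row hσ hz
  -- `∑ R = ∑ H - ∑ A - ∑ B`
  have hsplit : ∑' m : ℕ, hurwitzR σ (((m : ℂ) + 1) * z) =
      (∑' m : ℕ, ∑' n : ℕ, ((n : ℂ) + ((m : ℂ) + 1) * z) ^ (-σ)) -
        riemannZeta (σ - 1) * (z ^ (1 - σ) / (σ - 1)) - riemannZeta σ * (z ^ (-σ) / 2) := by
    rw [← hA.tsum_eq, ← hB.tsum_eq, ← hH.tsum_sub hA.summable, ← Summable.tsum_sub (hH.sub hA.summable) hB.summable]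
    refine tsum_congr fun m => ?_
    rw [hurwitzR_mul_eq (by linarith) hz m]
    ring
  rw [zagierPsi_def, hsplit]
  ring

/-- **Zagier's formula** [ChangMayer2001, (2.45)]: for `Re σ > 2`, `Re z > 0`,
`ψ(σ, z) = ∑_{m ≥ 1} ∑_{n ≥ 1} (mz + n)^{-σ} + ½ ζ(σ) (1 + z^{-σ})` (here with `m, n` shifted to
start at `0`): split off the column `n = 0` of the lattice form, which sums to `z^{-σ} ζ(σ)`.
[cite: ChangMayer2001, (2.45)] -/
theorem zagierPsi_eq_zagier {σ z : ℂ} (hσ : 2 < σ.re) (hz : 0 < z.re) :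
    zagierPsi σ z = (∑' m : ℕ, ∑' n : ℕ, (((n : ℂ) + 1) + ((m : ℂ) + 1) * z) ^ (-σ)) +
      riemannZeta σ / 2 * (1 + z ^ (-σ)) := by
  have hσ1 : 1 < σ.re := by linarith
  -- each row: `∑_{n≥0} (n + (m+1)z)^{-σ} = ((m+1)z)^{-σ} + ∑_{n≥0} ((n+1) + (m+1)z)^{-σ}`
  have hrow : ∀ m : ℕ, ∑' n : ℕ, ((n : ℂ) + ((m : ℂ) + 1) * z) ^ (-σ) =
      ((m : ℂ) + 1) ^ (-σ) * z ^ (-σ) + ∑' n : ℕ, (((n : ℂ) + 1) + ((m : ℂ) + 1) * z) ^ (-σ) := by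
    intro m
    rw [(summable_row hσ1 hz m).tsum_eq_zero_add, Nat.cast_zero, zero_add, natCast_succ_mul_cpow hz]
    congr 1
    refine tsum_congr fun n => ?_
    push_cast
    ring_nf
  have hcol : HasSum (fun m : ℕ => ((m : ℂ) + 1) ^ (-σ) * z ^ (-σ)) (riemannZeta σ * z ^ (-σ)) :=
    (hasSum_natCast_succ_cpow_neg (τ := σ) hσ1).mul_right _
  have hH := summable_tsum_row hσ hz
  have hrest : Summable fun m : ℕ => ∑' n : ℕ, (((n : ℂ) + 1) + ((m : ℂ) + 1) * z) ^ (-σ) := by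
    refine (hH.sub hcol.summable).congr fun m => ?_
    rw [hrow m]
    ring
  rw [zagierPsi_eq_tsum_add hσ hz, tsum_congr hrow, hcol.summable.tsum_add hrest, hcol.tsum_eq]
  ring

/-! ### The Lewis equation for `Re σ > 2` -/

/-- **Head–tail splitting of a row**: for `Re σ > 1`, `Re w > 0`,
`∑ₙ (n+(m+1)w)^{-σ} - ∑ₙ (n+(m+1)(w+1))^{-σ} = ∑_{n ≤ m} (n+(m+1)w)^{-σ}` (the second row is the
first one shifted by `m+1`). [folklore] -/
theorem tsum_row_sub_tsum_row_add_one {σ w : ℂ} (hσ : 1 < σ.re) (hw : 0 < w.re) (m : ℕ) :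
    (∑' n : ℕ, ((n : ℂ) + ((m : ℂ) + 1) * w) ^ (-σ)) -
        ∑' n : ℕ, ((n : ℂ) + ((m : ℂ) + 1) * (w + 1)) ^ (-σ) =
      ∑ n ∈ Finset.range (m + 1), ((n : ℂ) + ((m : ℂ) + 1) * w) ^ (-σ) := by
  have hs := summable_row hσ hw m
  have h := hs.sum_add_tsum_nat_add (m + 1)
  have hshift : ∀ n : ℕ, (((n + (m + 1) : ℕ) : ℂ) + ((m : ℂ) + 1) * w) ^ (-σ) =
      ((n : ℂ) + ((m : ℂ) + 1) * (w + 1)) ^ (-σ) := by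
    intro n; congr 1; push_cast; ring
  simp_rw [hshift] at h
  rw [← h]
  ring

/-- The transformed third term: for `Re w > 0`,
`w^{-σ} (n + (m+1)(1+1/w))^{-σ} = ((m+1) + (n+m+1) w)^{-σ}`. [folklore] -/
theorem cpow_mul_row_one_add_div {σ w : ℂ} (hw : 0 < w.re) (m n : ℕ) :
    w ^ (-σ) * ((n : ℂ) + ((m : ℂ) + 1) * (1 + 1 / w)) ^ (-σ) =
      (((m : ℂ) + 1) + ((n : ℂ) + m + 1) * w) ^ (-σ) := by
  have hw0 : w ≠ 0 := fun h => by rw [h, zero_re] at hw; exact lt_irrefl _ hw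
  have hu : 0 < ((n : ℂ) + ((m : ℂ) + 1) * (1 + 1 / w)).re := by
    have h1 := one_add_one_div_re_pos hw
    have h2 : (((m : ℂ) + 1) * (1 + 1 / w)).re = ((m : ℝ) + 1) * (1 + 1 / w).re := by
      simp [mul_re]
    simp only [add_re, natCast_re, h2]
    positivity
  rw [← mul_cpow_of_re_pos hw hu]
  congr 1
  field_simp
  ring

/-- The diagonal family `(m, n) ↦ ((m+1) + (n+m+1) w)^{-σ}` is absolutely summable on `ℕ × ℕ`
for `Re σ > 2`, `Re w > 0`: with `c = min 1 (Re w)` its norm is at most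
`e^{π|Im σ|/2} (c(m+1))^{-Re σ/2} (c(n+1))^{-Re σ/2}`. [folklore] -/
theorem summable_diag {σ w : ℂ} (hσ : 2 < σ.re) (hw : 0 < w.re) :
    Summable fun p : ℕ × ℕ => (((p.1 : ℂ) + 1) + ((p.2 : ℂ) + p.1 + 1) * w) ^ (-σ) := by
  set c : ℝ := min 1 w.re with hc
  have hc0 : 0 < c := lt_min one_pos hw
  have hc1 : c ≤ 1 := min_le_left _ _
  have hcw : c ≤ w.re := min_le_right _ _
  set E : ℝ := Real.exp (π / 2 * |σ.im|) with hE
  set f : ℕ → ℝ := fun m => (c * ((m : ℝ) + 1)) ^ (-(σ.re / 2)) with hf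
  have hfs : Summable f := by
    have h := (summable_nat_add_rpow_neg (x := 1) one_pos (by linarith : 0 < σ.re / 2 - 1)).mul_left
      (c ^ (-(σ.re / 2)))
    refine h.congr fun m => ?_
    simp only [hf]
    rw [Real.mul_rpow hc0.le (by positivity)]
    ring_nf
  have hf0 : 0 ≤ f := fun m => Real.rpow_nonneg (by positivity) _
  have hprod := (hfs.mul_of_nonneg hfs hf0 hf0).mul_left E
  refine Summable.of_norm_bounded hprod fun p => ?_
  obtain ⟨m, n⟩ := p
  -- real part of the base
  have hre : ((((m : ℂ) + 1) + ((n : ℂ) + m + 1) * w)).re = ((m : ℝ) + 1) + ((n : ℝ) + m + 1) * w.re := by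
    simp [mul_re]
  have hX : 0 < c * ((m : ℝ) + 1) := by positivity
  have hY : 0 < c * ((n : ℝ) + 1) := by positivity
  have hbase : c * ((m : ℝ) + 1) + c * ((n : ℝ) + 1) ≤ ((m : ℝ) + 1) + ((n : ℝ) + m + 1) * w.re := by
    have h1 : c * ((m : ℝ) + 1) ≤ (m : ℝ) + 1 := by nlinarith [m.cast_nonneg (α := ℝ)]
    have h2 : c * ((n : ℝ) + 1) ≤ ((n : ℝ) + m + 1) * w.re := by
      nlinarith [m.cast_nonneg (α := ℝ), n.cast_nonneg (α := ℝ)]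
    linarith
  have hpos : 0 < ((((m : ℂ) + 1) + ((n : ℂ) + m + 1) * w)).re := by rw [hre]; linarith
  have hw' : (-σ).re ≤ 0 := by simp; linarith
  refine (norm_cpow_le_re_rpow_of_re_pos hpos hw').trans ?_
  rw [neg_re, neg_im, abs_neg, hre, mul_comm]
  change E * (((m : ℝ) + 1 + ((n : ℝ) + m + 1) * w.re) ^ (-σ.re)) ≤ E * (f m * f n)
  refine mul_le_mul_of_nonneg_left ?_ (Real.exp_pos _).le
  -- `(X + Y)^{-s} ≤ (X Y)^{-s/2}` for `X, Y > 0`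
  have hXY : Real.sqrt (c * ((m : ℝ) + 1) * (c * ((n : ℝ) + 1))) ≤
      c * ((m : ℝ) + 1) + c * ((n : ℝ) + 1) := by
    rw [Real.sqrt_le_left (by positivity)]
    nlinarith
  calc (((m : ℝ) + 1 + ((n : ℝ) + m + 1) * w.re)) ^ (-σ.re)
      ≤ (Real.sqrt (c * ((m : ℝ) + 1) * (c * ((n : ℝ) + 1)))) ^ (-σ.re) :=
        Real.rpow_le_rpow_of_nonpos (Real.sqrt_pos.mpr (by positivity)) (hXY.trans hbase) (by linarith)
    _ = f m * f n := by
        simp only [hf]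
        rw [Real.sqrt_eq_rpow, ← Real.rpow_mul (by positivity), Real.mul_rpow hX.le hY.le]
        ring_nf

/-- **Antidiagonal regrouping** of the diagonal family: for `Re σ > 2`, `Re w > 0`,
`∑_{(m,n)} ((m+1) + (n+m+1) w)^{-σ} = ∑ₖ ∑_{i ≤ k} ((i+1) + (k+1) w)^{-σ}`, the `k`-family being
summable. [folklore] -/
theorem hasSum_diag {σ w : ℂ} (hσ : 2 < σ.re) (hw : 0 < w.re) :
    HasSum (fun k : ℕ => ∑ i ∈ Finset.range (k + 1), (((i : ℂ) + 1) + ((k : ℂ) + 1) * w) ^ (-σ))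
      (∑' p : ℕ × ℕ, (((p.1 : ℂ) + 1) + ((p.2 : ℂ) + p.1 + 1) * w) ^ (-σ)) := by
  set G : ℕ × ℕ → ℂ := fun p => (((p.1 : ℂ) + 1) + ((p.2 : ℂ) + p.1 + 1) * w) ^ (-σ) with hG
  have hGs : Summable G := summable_diag hσ hw
  set e := (Finset.HasAntidiagonal.sigmaAntidiagonalEquivProd (A := ℕ)) with he
  have hGe : Summable (G ∘ e) := e.summable_iff.mpr hGs
  -- fiberwise sums
  have hfib : ∀ k : ℕ, HasSum (fun c : Finset.antidiagonal k => (G ∘ e) ⟨k, c⟩)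
      (∑ i ∈ Finset.range (k + 1), (((i : ℂ) + 1) + ((k : ℂ) + 1) * w) ^ (-σ)) := by
    intro k
    have h1 := hasSum_fintype (fun c : Finset.antidiagonal k => (G ∘ e) ⟨k, c⟩)
    convert h1 using 1
    have hfun : (fun c : Finset.antidiagonal k => (G ∘ e) ⟨k, c⟩) =
        fun c : Finset.antidiagonal k => G (c : ℕ × ℕ) := by
      funext c
      simp [he]
    rw [hfun, Finset.sum_coe_sort (Finset.antidiagonal k) G,
      Finset.Nat.sum_antidiagonal_eq_sum_range_succ_mk]
    refine Finset.sum_congr rfl fun i hi => ?_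
    have hi' : i ≤ k := Nat.lt_succ_iff.mp (Finset.mem_range.mp hi)
    simp only [hG]
    congr 2
    push_cast [Nat.cast_sub hi']
    ring
  have h := hGe.hasSum.sigma hfib
  convert h using 1
  exact (e.tsum_eq G).symm

/-- The telescoped `k`-th term: `T(k,0) - T(k,k+1) = (k+1)^{-σ} (w^{-σ} - (w+1)^{-σ})`. [folklore] -/
theorem row_zero_sub_row_diag {σ w : ℂ} (hw : 0 < w.re) (k : ℕ) :
    (((0 : ℕ) : ℂ) + ((k : ℂ) + 1) * w) ^ (-σ) - ((((k + 1 : ℕ)) : ℂ) + ((k : ℂ) + 1) * w) ^ (-σ) =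
      ((k : ℂ) + 1) ^ (-σ) * (w ^ (-σ) - (w + 1) ^ (-σ)) := by
  have hw1 : 0 < (w + 1).re := by simp only [add_re, one_re]; linarith
  have hbase : (((k + 1 : ℕ)) : ℂ) + ((k : ℂ) + 1) * w = ((k : ℂ) + 1) * (w + 1) := by
    push_cast; ring
  rw [Nat.cast_zero, zero_add, hbase, natCast_succ_mul_cpow hw, natCast_succ_mul_cpow hw1]
  ring

/-- **The Lewis (three-term) functional equation for `Re σ > 2`**: for `Re w > 0`,
`ψ(σ, w) - ψ(σ, w+1) = w^{-σ} ψ(σ, 1 + 1/w)` — Zagier's observation, by rearranging the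
absolutely convergent lattice sums: the rows of `ψ(w+1)` are the tails of the rows of `ψ(w)`, the
third term is the sum over the transposed strict triangle, and what is left telescopes to
`ζ(σ)(w^{-σ} - (w+1)^{-σ})`, which the `ζ(σ)/2` terms cancel. [cite: ChangMayer2001, (2.45) and Prop. 4.2] -/
theorem zagierPsi_lewis_of_two_lt {σ w : ℂ} (hσ : 2 < σ.re) (hw : 0 < w.re) :
    zagierPsi σ w - zagierPsi σ (w + 1) = w ^ (-σ) * zagierPsi σ (1 + 1 / w) := by
  have hw1 : 0 < (w + 1).re := by simp only [add_re, one_re]; linarith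
  have hw2 : 0 < (1 + 1 / w).re := one_add_one_div_re_pos hw
  have hσ1 : 1 < σ.re := by linarith
  have hH := summable_tsum_row hσ hw
  have hH1 := summable_tsum_row hσ hw1
  -- Step 1: rows of `ψ(w)` minus rows of `ψ(w+1)` are heads
  have h1 : (∑' m : ℕ, ∑' n : ℕ, ((n : ℂ) + ((m : ℂ) + 1) * w) ^ (-σ)) -
      ∑' m : ℕ, ∑' n : ℕ, ((n : ℂ) + ((m : ℂ) + 1) * (w + 1)) ^ (-σ) =
      ∑' m : ℕ, ∑ n ∈ Finset.range (m + 1), ((n : ℂ) + ((m : ℂ) + 1) * w) ^ (-σ) := by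
    rw [← hH.tsum_sub hH1]
    exact tsum_congr fun m => tsum_row_sub_tsum_row_add_one hσ1 hw m
  -- Step 2: the third term is the diagonal family, regrouped along antidiagonals
  have hG := summable_diag hσ hw
  have h2 : w ^ (-σ) * ∑' m : ℕ, ∑' n : ℕ, ((n : ℂ) + ((m : ℂ) + 1) * (1 + 1 / w)) ^ (-σ) =
      ∑' k : ℕ, ∑ i ∈ Finset.range (k + 1), (((i : ℂ) + 1) + ((k : ℂ) + 1) * w) ^ (-σ) := by
    rw [← tsum_mul_left]
    simp_rw [← tsum_mul_left]
    simp_rw [cpow_mul_row_one_add_div hw]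
    rw [← hG.tsum_prod' fun m => hG.prod_factor m]
    exact (hasSum_diag hσ hw).tsum_eq.symm
  -- Step 3: the difference of the two `k`-families telescopes
  have hs1 : Summable fun m : ℕ => ∑ n ∈ Finset.range (m + 1), ((n : ℂ) + ((m : ℂ) + 1) * w) ^ (-σ) :=
    (hH.sub hH1).congr fun m => tsum_row_sub_tsum_row_add_one hσ1 hw m
  have hs2 := (hasSum_diag hσ hw).summable
  have h4 : (∑' m : ℕ, ∑ n ∈ Finset.range (m + 1), ((n : ℂ) + ((m : ℂ) + 1) * w) ^ (-σ)) -
      ∑' k : ℕ, ∑ i ∈ Finset.range (k + 1), (((i : ℂ) + 1) + ((k : ℂ) + 1) * w) ^ (-σ) =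
      riemannZeta σ * (w ^ (-σ) - (w + 1) ^ (-σ)) := by
    rw [← hs1.tsum_sub hs2]
    have hz := ((hasSum_natCast_succ_cpow_neg (τ := σ) hσ1).mul_right (w ^ (-σ) - (w + 1) ^ (-σ))).tsum_eq
    rw [← hz]
    refine tsum_congr fun k => ?_
    have htel : ∑ i ∈ Finset.range (k + 1), ((((i : ℕ) : ℂ) + ((k : ℂ) + 1) * w) ^ (-σ) -
        ((((i + 1 : ℕ)) : ℂ) + ((k : ℂ) + 1) * w) ^ (-σ)) =
        (((0 : ℕ) : ℂ) + ((k : ℂ) + 1) * w) ^ (-σ) - ((((k + 1 : ℕ)) : ℂ) + ((k : ℂ) + 1) * w) ^ (-σ) :=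
      Finset.sum_range_sub' (fun i : ℕ => ((i : ℂ) + ((k : ℂ) + 1) * w) ^ (-σ)) (k + 1)
    rw [← row_zero_sub_row_diag hw k, ← htel, Finset.sum_sub_distrib]
    congr 1
    refine Finset.sum_congr rfl fun i _ => ?_
    push_cast
    ring_nf
  -- Step 4: the branch identity for the constants
  have h6 : w ^ (-σ) * (1 + 1 / w) ^ (-σ) = (w + 1) ^ (-σ) := cpow_mul_one_add_one_div_cpow hw (-σ)
  rw [zagierPsi_eq_tsum_add hσ hw, zagierPsi_eq_tsum_add hσ hw1, zagierPsi_eq_tsum_add hσ hw2]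
  linear_combination h1 + h4 - h2 + (riemannZeta σ / 2) * h6

end Literature.Dynamics.TransferOperators
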